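import Summits.CriticalPhenomena.SAWScalingLimit.Theorems.SAWReversalUpgradeFaithfulOfNoReturnModelExit
import HarnessLib

/-!
# Route `SAWReversalUpgrade`, support `FaithfulOfNoReturn` (stmt-CriticalPhenomena-18008):
# the deterministic faithfulness estimate

Helper file (9 of several) for the proof of
`Summit.CriticalPhenomena.SAWScalingLimit.Theses.SAWReversalUpgrade.FaithfulOfNoReturn`.

**Theorem `reparamDist_le_of_standard`.** Let `P` be a flat curve in `closure D` with endpoints in
`D`, `r₀/4`-close to `a` and `b`, on the good event (no `(ε₀, r₀)`-deep return to `a`, no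
`(r₀, ε₀)`-escape from `b`), with the squeeze `κ ≤ r₀/4`-close to the identity through `Φ`, and the
access segment / exit ray small (`r₀/4`). Then every standard attachment `c` of `projLine P`
(`c ∈ AttachReversal.standardCurves …`) is at reparametrisation distance `≤ ε₀ + r₀/4` from `P`.

Proof: the model curve `m = access ⋆ middle ⋆ exit` (helper files 7, 8) is flat, runs from `a` to
`b`, and has trace `attSet = range c`; by the monotone–light factorisation
(`Curve.exists_isSimple_of_isFlat`) it is at distance `0` from a simple curve `m₀` with the same
trace, which is at distance `0` from `c` (`reparamDist_eq_zero_of_isSimple`); finally `m` is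
pointwise `(ε₀ + r₀/4)`-close to `P ∘ θ` for the monotone time change `θ = (t u) ⋆ (u + t(v-u)) ⋆
(v + t(1-v))`, and `dist (P ∘ θ) P = 0` (`Curve.dist_precomp_eq_zero`).
-/

noncomputable section

open Set Filter Metric Complex Function
open scoped Topology unitInterval
open UpperHalfPlane (upperHalfPlaneSet)
open Literature.Probability.RandomPlanarGeometry

namespace Summit.CriticalPhenomena.SAWScalingLimit.Theorems

namespace FaithfulAttach

open AttachReversal

variable {D : DobrushinDomain} {φ : ConformalEquiv upperHalfPlaneSet D.carrier} {e : ℝ}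

/-- `projLine P` is continuous. -/
theorem continuous_projLine (P : C(I, ℂ)) : Continuous (projLine P) :=
  P.continuous.comp continuous_projIcc

/-- `projLine P 0 = P 0`. -/
theorem projLine_zero (P : C(I, ℂ)) : projLine P 0 = P 0 := by
  show P (projIcc 0 1 zero_le_one 0) = P 0
  rw [projIcc_left]
  rfl

/-- `projLine P 1 = P 1`. -/
theorem projLine_one (P : C(I, ℂ)) : projLine P 1 = P 1 := by
  show P (projIcc 0 1 zero_le_one 1) = P 1
  rw [projIcc_right]
  rfl

/-- **The deterministic faithfulness estimate** (see the module docstring). -/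
theorem reparamDist_le_of_standard (hφ : D.IsChordalUniformizing φ) (he0 : 0 < e) (he1 : e ≤ 1 / 2)
    {P : C(I, ℂ)} {ε₀ r₀ κ : ℝ} {c : Curve ℂ}
    (hPmem : ∀ t : I, P t ∈ closure D.carrier) (hP0 : P 0 ∈ D.carrier) (hP1 : P 1 ∈ D.carrier)
    (hflat : (⟨P⟩ : Curve ℂ).IsFlat)
    (hr₀ : 0 < r₀) (hrε : r₀ < ε₀) (hab : 2 * ε₀ ≤ dist (D.pt 0) (D.pt 1))
    (hκ : 0 < κ) (hκr : κ ≤ r₀ / 4)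
    (hclose : ∀ z : ℂ, 0 ≤ z.im →
      dist (φ.boundaryExtension (squeeze e z)) (φ.boundaryExtension z) < κ)
    (hacc : ∀ z : ℂ, 0 ≤ z.im → ‖z‖ ≤ ‖hinv φ.boundaryExtension (projLine P 0)‖ →
      dist (φ.boundaryExtension z) (D.pt 0) < r₀ / 4)
    (hex : ∀ z : ℂ, 0 ≤ z.im → ‖hinv φ.boundaryExtension (projLine P 1)‖ ≤ ‖z‖ →
      dist (φ.boundaryExtension z) (D.pt 1) < r₀ / 4)
    (hR0 : dist (projLine P 0) (D.pt 0) < r₀ / 4) (hR1 : dist (projLine P 1) (D.pt 1) < r₀ / 4)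
    (hNR : ∀ s t : ℝ, 0 ≤ s → s < t → t ≤ 1 → ε₀ ≤ dist (projLine P s) (D.pt 0) →
      dist (projLine P t) (D.pt 0) ≤ r₀ → False)
    (hNE : ∀ s t : ℝ, 0 ≤ t → t < s → s ≤ 1 → dist (projLine P t) (D.pt 1) ≤ r₀ →
      ε₀ ≤ dist (projLine P s) (D.pt 1) → False)
    (hc : c ∈ standardCurves (D.pt 0) (D.pt 1) φ.boundaryExtension e (projLine P) D.carrier) :
    Curve.reparamDist c ⟨P⟩ ≤ ε₀ + r₀ / 4 := by
  set R := projLine P with hR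
  have hRc : Continuous R := continuous_projLine P
  have hRmem : ∀ u, R u ∈ closure D.carrier := fun u => hPmem _
  have hR0D : R 0 ∈ D.carrier := by rw [hR, projLine_zero]; exact hP0
  have hR1D : R 1 ∈ D.carrier := by rw [hR, projLine_one]; exact hP1
  have hab' : D.pt 0 ≠ D.pt 1 := D.pt_injective.ne (by decide)
  have hij : lastA (D.pt 0) R < firstB (D.pt 1) R := lastA_lt_firstB hRc hr₀ hrε hab hR0 hR1 hNE
  -- the cut times
  set u := uMid (D.pt 0) (D.pt 1) φ.boundaryExtension e R with hu
  set v := vMid (D.pt 0) (D.pt 1) φ.boundaryExtension e R with hv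
  obtain ⟨huI, huZ, -⟩ := uMid_facts hφ he0 he1 hRc hRmem hR0D hij.le
  have hvI := vMid_mem_Icc hφ he0 he1 hRc hRmem hR1D hij.le
  have huv : u < v :=
    uMid_lt_vMid hφ he0 he1 hRc hRmem hR1D hij.le hrε hab hκ hκr hR0D hclose hacc hex hNE
  have hi0 := (lastA_mem_Icc' hRc (D.pt 0)).1
  have hj1 := (firstB_mem_Icc' hRc (D.pt 1)).2
  have hu01 : u ∈ Icc (0:ℝ) 1 := ⟨hi0.trans huI.1, huI.2.trans hj1⟩
  have hv01 : v ∈ Icc (0:ℝ) 1 := ⟨hi0.trans hvI.1, hvI.2.trans hj1⟩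
  -- the three pieces of the model curve
  obtain ⟨γ₁, h1flat, h1range, h1junc, h1dist⟩ := exists_accessPath hφ he0 he1 hRc hRmem hR0D hij.le hacc
  obtain ⟨γ₂, h2flat, h2range, h2eq⟩ := exists_midPath hφ he0 he1 hRc hRmem hR hflat hu01 hv01 huv.le
  obtain ⟨γ₃, h3flat, h3range, h3junc, h3dist⟩ := exists_exitPath hφ he0 he1 hRc hRmem hR1D hij.le hr₀ hex
  -- middle values lie in `midSet`
  have hmidM : ∀ t : I, γ₂ t ∈ midSet (D.pt 0) (D.pt 1) φ.boundaryExtension e R := fun t => by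
    have : γ₂ t ∈ Set.range γ₂ := mem_range_self t
    rw [h2range] at this
    obtain ⟨y, hy, hyt⟩ := this
    exact ⟨y, ⟨huI.1.trans hy.1, hy.2.trans hvI.2⟩, hyt⟩
  -- the model curve
  let γ₂' : Path (φ.boundaryExtension ((sAcc (D.pt 0) (D.pt 1) φ.boundaryExtension e R : ℂ) *
      pAcc (D.pt 0) φ.boundaryExtension e R)) (attZ (D.pt 1) φ.boundaryExtension e R v) :=
    γ₂.cast huZ.symm rfl
  have h2'eq : ∀ t, γ₂' t = γ₂ t := fun t => rfl
  let m : Path (D.pt 0) (D.pt 1) := γ₁.trans (γ₂'.trans γ₃)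
  -- flatness of the model curve
  have h23 : (Curve.ofPath (γ₂'.trans γ₃)).IsFlat := by
    refine isFlat_ofPath_trans h2flat h3flat fun s t hst => ?_
    rw [h2'eq] at hst ⊢
    have h := h3junc t (hst ▸ hmidM s)
    rw [hst, h]
  have hm_flat : (Curve.ofPath m).IsFlat := by
    refine isFlat_ofPath_trans h1flat h23 fun s t hst => ?_
    have hmem : (γ₂'.trans γ₃) t ∈ Set.range (γ₂'.trans γ₃) := mem_range_self t
    rw [Path.trans_range] at hmem
    rcases hmem with ⟨t', ht'⟩ | ⟨t', ht'⟩
    · exact h1junc s (by rw [hst, ← ht', h2'eq]; exact hmidM t')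
    · exfalso
      have h1 := h1dist s
      have h3 := h3dist t'
      rw [ht', ← hst] at h3
      have := dist_triangle_left (D.pt 0) (D.pt 1) (γ₁ s)
      linarith
  have h01 : (Curve.ofPath m) 0 ≠ (Curve.ofPath m) 1 := by
    change m 0 ≠ m 1
    rw [m.source, m.target]
    exact hab'
  -- monotone–light factorisation
  obtain ⟨m₀, hm₀s, hm₀pre, hm₀dist⟩ := Curve.exists_isSimple_of_isFlat hm_flat h01
  have hrange_m₀ : Set.range m₀ = Set.range m := by
    have hfun : (⇑(m₀.precomp ((Curve.ofPath m).collapse h01)) : I → ℂ) =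
        ⇑m₀ ∘ ⇑((Curve.ofPath m).collapse h01) := funext fun t => Curve.precomp_apply _ _ _
    have h1 : Set.range (m₀.precomp ((Curve.ofPath m).collapse h01)) = Set.range m₀ := by
      rw [hfun, ((Curve.ofPath m).surjective_collapse h01).range_comp]
    rw [← h1, hm₀pre]
    rfl
  have hm₀0 : m₀ 0 = D.pt 0 := by
    have := congrArg (fun γ : Curve ℂ => γ 0) hm₀pre
    simp only [Curve.precomp_apply, Curve.collapse_zero] at this
    rw [this]
    exact m.source
  -- the trace of the model curve is the prescribed trace `attSet`
  obtain ⟨hs01, -, hα0, -⟩ := sAcc_facts hφ he0 he1 hRc hRmem hR0D hij.le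
  have hrange_m : Set.range m = attSet (D.pt 0) (D.pt 1) φ.boundaryExtension e R := by
    have h2'range : Set.range γ₂' = attZ (D.pt 1) φ.boundaryExtension e R '' Icc u v := h2range
    rw [Path.trans_range, Path.trans_range, h1range, h2'range, h3range, ← Ioc_insert_left hs01.1,
      image_insert_eq, hα0]
    ext x
    simp only [attSet, mem_union, mem_insert_iff, mem_singleton_iff]
    tauto
  -- the attachment has the same trace and the same endpoints
  obtain ⟨hcinj, hcsrc, -, -, hcrange, -⟩ := hc
  have hrange_c : Set.range c = Set.range m₀ := by rw [hrange_m₀, hrange_m]; exact hcrange huv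
  have hc0 : c 0 = m₀ 0 := by rw [hm₀0]; exact hcsrc
  have hcm₀ : Curve.reparamDist c m₀ = 0 := reparamDist_eq_zero_of_isSimple hcinj hm₀s hrange_c hc0
  -- the time change
  obtain ⟨θ₁, θ₂, θ₃, hθ₁m, hθ₂m, hθ₃m, hθ₁, hθ₂, hθ₃⟩ := exists_timeChanges hu01 hv01 huv.le
  let θ : Path (0 : I) 1 := θ₁.trans (θ₂.trans θ₃)
  have hθm : Monotone θ := monotone_trans hθ₁m (monotone_trans hθ₂m hθ₃m)
  have hPθ : dist ((⟨P⟩ : Curve ℂ).precomp θ.toContinuousMap) ⟨P⟩ = 0 :=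
    Curve.dist_precomp_eq_zero _ _ hθm θ.source θ.target
  -- pointwise closeness of the model curve to `P ∘ θ`
  have hRP : ∀ t : I, R t = P t := fun t => projLine_apply_coe P t
  have hC : 0 ≤ ε₀ + r₀ / 4 := by linarith
  have hpt : ∀ τ : I, dist (m τ) (P (θ τ)) ≤ ε₀ + r₀ / 4 := by
    intro τ
    refine dist_trans_trans_le P (fun t => ?_) (dist_trans_trans_le P (fun t => ?_) (fun t => ?_)) τ
    · -- access piece against `P` on `[0, u]`
      have hmem : (t : ℝ) * u ∈ Icc (0:ℝ) 1 :=
        ⟨mul_nonneg t.2.1 hu01.1, (mul_le_of_le_one_left hu01.1 t.2.2).trans hu01.2⟩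
      have h1 := h1dist t
      have h2 : dist (R ((t : ℝ) * u)) (D.pt 0) < ε₀ :=
        dist_lt_of_le_uMid hφ he0 he1 hRc hRmem hR0D hij.le hrε hκ hκr hclose hacc hNR hmem.1
          (mul_le_of_le_one_left hu01.1 t.2.2)
      have h3 : P (θ₁ t) = R ((t : ℝ) * u) := by rw [← hθ₁ t, hRP]
      rw [h3]
      linarith [dist_triangle (γ₁ t) (D.pt 0) (R ((t : ℝ) * u)), dist_comm (D.pt 0) (R ((t : ℝ) * u))]
    · -- middle piece: the squeeze displacement
      have h3 : P (θ₂ t) = R (u + (t : ℝ) * (v - u)) := by rw [← hθ₂ t, hRP]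
      rw [h2'eq, h2eq t, h3]
      have hd : dist (attZ (D.pt 1) φ.boundaryExtension e R (u + (t : ℝ) * (v - u)))
          (R (u + (t : ℝ) * (v - u))) < κ := dist_transport'_lt hφ hκ hclose (hRmem _)
      exact hd.le.trans (by linarith)
    · -- exit piece against `P` on `[v, 1]`
      have hmem : v + (t : ℝ) * (1 - v) ∈ Icc v 1 :=
        ⟨le_add_of_nonneg_right (mul_nonneg t.2.1 (sub_nonneg.2 hv01.2)), by nlinarith [t.2.2, hv01.2]⟩
      have h1 := h3dist t
      have h2 : dist (R (v + (t : ℝ) * (1 - v))) (D.pt 1) < ε₀ :=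
        dist_lt_of_vMid_le hφ he0 he1 hRc hRmem hR1D hij.le hrε hκ hκr hclose hex hNE hmem.1 hmem.2
      have h3 : P (θ₃ t) = R (v + (t : ℝ) * (1 - v)) := by rw [← hθ₃ t, hRP]
      rw [h3]
      linarith [dist_triangle (γ₃ t) (D.pt 1) (R (v + (t : ℝ) * (1 - v))),
        dist_comm (D.pt 1) (R (v + (t : ℝ) * (1 - v)))]
  have hmP : dist (Curve.ofPath m) ((⟨P⟩ : Curve ℂ).precomp θ.toContinuousMap) ≤ ε₀ + r₀ / 4 := by
    refine (Curve.dist_le_dist_toContinuousMap _ _).trans ?_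
    refine (ContinuousMap.dist_le hC).2 fun τ => ?_
    exact hpt τ
  -- assemble
  calc Curve.reparamDist c ⟨P⟩ = dist c ⟨P⟩ := rfl
    _ ≤ dist c m₀ + dist m₀ (Curve.ofPath m) + dist (Curve.ofPath m) ⟨P⟩ := dist_triangle4 _ _ _ _
    _ ≤ 0 + 0 + (ε₀ + r₀ / 4) := by
        gcongr
        · exact hcm₀.le
        · rw [dist_comm]; exact hm₀dist.le
        · calc dist (Curve.ofPath m) ⟨P⟩
              ≤ dist (Curve.ofPath m) ((⟨P⟩ : Curve ℂ).precomp θ.toContinuousMap) +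
                dist ((⟨P⟩ : Curve ℂ).precomp θ.toContinuousMap) ⟨P⟩ := dist_triangle _ _ _
            _ ≤ (ε₀ + r₀ / 4) + 0 := add_le_add hmP hPθ.le
            _ = ε₀ + r₀ / 4 := add_zero _
    _ = ε₀ + r₀ / 4 := by ring

end FaithfulAttach

end Summit.CriticalPhenomena.SAWScalingLimit.Theorems
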